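import Summits.NavierStokesRegularity.NavierStokesRegularity.Theorems.FilamentSkeletonRssBoxSelectionRJ
import Summits.NavierStokesRegularity.NavierStokesRegularity.Theorems.FilamentSkeletonRssSkeletonJ1RSplit

/-!
# Route `FilamentSkeletonRss` · glue `Selection1ARcof` (stmt-NavierStokesRegularity-24203; COFINAL TWIN of Variant A1R):
# `SkeletonJ1Rcof → TransverseReduction1AR → RssProfileExists`

PORT of the landed `selection1AR_proof` (`Theorems/FilamentSkeletonRssSelection1AR.lean`, p673139, LEAD ns-filament-21221-p1 g12) to the cofinal twin
`SkeletonJ1Rcof` (stmt-NavierStokesRegularity-24202; tenure g29, route rev 72): the ∀-side crux `TransverseReduction1AR` supplies a threshold `Γ₁`,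
cofinality supplies ONE skeleton at SOME `Γ ≥ Γ₁` (instead of `Γ := max Γ₁ Γ₂`), the skeleton's clause block (ending in clause 13-R) is handed to the
∀-crux as ONE hypothesis and never inspected, and the resulting exact smooth decaying rotated-Leray profile with rate `α₁ ≠ 0` gives `RssProfileExists`
via the tree's `Theorems.stub_rssProfileExists_of_profile`.  The single changed line w.r.t. `selection1AR_proof` is the `obtain` that picks the skeleton.
This is the strategist's `Cruxes/SkeletonJ1R/CofinalSelectionGlue.lean` `selection_cof` / tenure g29's `Sketch-cof.lean` `selection1ARcof_proof`, stated
against the ROUTE decls by name.  Corollaries: the crux of record implies its twin (`skeletonJ1Rcof_of_skeletonJ1R`) and hence the record glue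
`Selection1AR` (stmt-23613, already proved) follows from the twin glue (`selection1AR_of_selection1ARcof`).
HONEST FRAMING: logic-only glue between two OPEN statements of a MODEL route (negative side); nothing here bears on Navier–Stokes regularity or blow-up.
-/

set_option linter.dupNamespace false

noncomputable section

namespace Summit.NavierStokesRegularity.NavierStokesRegularity.Theorems

open Set Function Filter MeasureTheory Real
open Literature.Analysis.FluidPDE Literature.Analysis.FluidPDE.PineauVicol2026
open Summit.NavierStokesRegularity.NavierStokesRegularity.Theses.FilamentSkeletonRss
open scoped InnerProductSpace Laplacian ContDiff Topology BigOperators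

/-- **Glue `Selection1ARcof` (stmt-NavierStokesRegularity-24203), PROVED**: `SkeletonJ1Rcof → TransverseReduction1AR → RssProfileExists`
(proof body of the landed `selection1AR_proof`, p673139, with the one change that the skeleton is taken at SOME `Γ ≥ Γ₁` supplied by cofinality
instead of at `max Γ₁ Γ₂`; the clause block is passed to the ∀-crux as ONE hypothesis and never inspected). -/
theorem selection1ARcof_proof :
    Summit.NavierStokesRegularity.NavierStokesRegularity.Theses.FilamentSkeletonRss.Selection1ARcof := by
  unfold Selection1ARcof
  intro hbox hred
  classical
  obtain ⟨N, δ, ρ, K, Λ, a, b, cnd, η, Rw, Rb, cg, θ₀, KA, hN, hδ, hρ, ha, _hcnd, hη, hRw, hRb, hcg, hθ₀, hbox⟩ :=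
    hbox
  obtain ⟨Γ₁, hred⟩ := hred N δ ρ K Λ a b cnd η Rw Rb cg θ₀ KA hN hδ hρ ha hη hRw hRb hcg hθ₀
  obtain ⟨Γ, hΓ₁, γ, α, X, w, c, m, n, Aa, hfam⟩ := hbox Γ₁
  set u : (Fin N → ℝ → EuclideanSpace ℝ (Fin 3)) → EuclideanSpace ℝ (Fin 3) → EuclideanSpace ℝ (Fin 3) :=
    fun Z y => ∑ k : Fin N, (Γ * γ k / (4 * π)) • ∫ σ : ℝ,
        ((‖y - Z k σ‖ ^ 2 + Real.exp (-(1 + Real.eulerMascheroniConstant - Real.log 2)) * Aa k σ) ^ (3 / 2 : ℝ))⁻¹ •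
          cross (deriv (Z k) σ) (y - Z k σ)
  set v : EuclideanSpace ℝ (Fin 3) → EuclideanSpace ℝ (Fin 3) :=
    fun y => u X y + (1 / 2 : ℝ) • y - α • cross (EuclideanSpace.single (2 : Fin 3) (1 : ℝ)) y
  set A : Fin N → (EuclideanSpace ℝ (Fin 3) →L[ℝ] EuclideanSpace ℝ (Fin 3)) := fun j => fderiv ℝ v (X j (c j))
  set T : (Fin N → ℝ → EuclideanSpace ℝ (Fin 3)) → Fin N → ℝ → EuclideanSpace ℝ (Fin 3) :=
    fun Z j τ => (u Z (Z j τ) + (1 / 2 : ℝ) • Z j τ - α • cross (EuclideanSpace.single (2 : Fin 3) (1 : ℝ)) (Z j τ)) -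
      (inner ℝ (u Z (Z j τ) + (1 / 2 : ℝ) • Z j τ - α • cross (EuclideanSpace.single (2 : Fin 3) (1 : ℝ)) (Z j τ)) (deriv (Z j) τ) /
        ‖deriv (Z j) τ‖ ^ 2) • deriv (Z j) τ
  have hskel := hfam u v A T (fun _ _ => rfl) (fun _ => rfl) (fun _ => rfl) (fun _ _ _ => rfl)
  obtain ⟨α₁, C₀, M, U, P, hα₁, hU0, hUs, hPs, hdiv, heq, hdec, hPM, -⟩ := hred Γ hΓ₁ γ α X w c m n Aa u v A T
    (fun _ _ => rfl) (fun _ => rfl) (fun _ => rfl) (fun _ _ _ => rfl) hskel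
  have heq0 : ∀ y : EuclideanSpace ℝ (Fin 3), α₁ • (rotGen (U y) - fderiv ℝ U y (rotGen y)) +
      (1 / 2 : ℝ) • U y + (1 / 2 : ℝ) • fderiv ℝ U y y - (Δ U) y + fderiv ℝ U y (U y) + gradient P y = 0 := by
    intro y
    simp only [splitGlue_rotGen_eq_cross_single_two]
    exact heq y
  exact stub_rssProfileExists_of_profile ⟨α₁, C₀, M, U, P, hα₁, hU0, hUs, hPs, hdiv, heq0, hdec, hPM⟩

/-- The crux of record `SkeletonJ1R` (stmt-NavierStokesRegularity-23610) implies its cofinal twin `SkeletonJ1Rcof`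
(stmt-NavierStokesRegularity-24202): take `Γ := max Γ₁ Γ₂` (the two matrices agree literally via the landed `J1RMatrix` split). -/
theorem skeletonJ1Rcof_of_skeletonJ1R
    (h : Summit.NavierStokesRegularity.NavierStokesRegularity.Theses.FilamentSkeletonRss.SkeletonJ1R) :
    Summit.NavierStokesRegularity.NavierStokesRegularity.Theses.FilamentSkeletonRss.SkeletonJ1Rcof := by
  obtain ⟨N, δ, ρ, K, Λ, a, b, cnd, η, Rw, Rb, cg, θ₀, KA, Γ₂, hN, hδ, hρ, ha, hcnd, hη, hRw, hRb, hcg, hθ₀, hbox⟩ :=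
    FilamentSkeletonRssSkeletonJ1RSplit.skeletonJ1R_iff_matrix.mp h
  refine ⟨N, δ, ρ, K, Λ, a, b, cnd, η, Rw, Rb, cg, θ₀, KA, hN, hδ, hρ, ha, hcnd, hη, hRw, hRb, hcg, hθ₀, fun Γ₁ => ?_⟩
  exact ⟨max Γ₁ Γ₂, le_max_left _ _, hbox (max Γ₁ Γ₂) (le_max_right _ _)⟩

/-- Hence the record glue `Selection1AR` (stmt-NavierStokesRegularity-23613, proved as `selection1AR_proof`) also follows from the twin glue:
the twin route position dominates the record one. -/
theorem selection1AR_of_selection1ARcof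
    (h : Summit.NavierStokesRegularity.NavierStokesRegularity.Theses.FilamentSkeletonRss.Selection1ARcof) :
    Summit.NavierStokesRegularity.NavierStokesRegularity.Theses.FilamentSkeletonRss.Selection1AR :=
  fun hSkR hTR => h (skeletonJ1Rcof_of_skeletonJ1R hSkR) hTR

end Summit.NavierStokesRegularity.NavierStokesRegularity.Theorems
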